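import Summits.Ventures.CertifiedArithmetic.Expansions.Orient3dStageBExpansion
import Mathlib.Tactic.Linarith
import Mathlib.Tactic.Ring
import Mathlib.Tactic.NormNum

/-!
# INCIRCLE, stage B: the exact expansion over the computed differences is a W-expansion

NEW WORK in the sense of this development (the algorithm is Shewchuk's; definitions over `ℚ`,
statements and proofs are ours; nothing here is cited anywhere as a literature fact).

THE OBJECT.  INCIRCLE(a, b, c, d) is the sign of
`Σ_cyclic ((a_x − d_x)² + (a_y − d_y)²)·((b_x − d_x)(c_y − d_y) − (c_x − d_x)(b_y − d_y))`
[Shewchuk1997, §4.5].  After the floating-point filter (stage A,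
`Literature/…/Shewchuk1997/IncircleStageA.lean`) fails, the adaptive routine computes the six
differences `x_a = a_x ⊖ d_x, …, y_c = c_y ⊖ d_y` in floating point and then EXACTLY, in expansion
arithmetic, the determinant of these COMPUTED differences
`B = (x_a² + y_a²)·(x_b·y_c − x_c·y_b) + (x_b² + y_b²)·(x_c·y_a − x_a·y_c)
   + (x_c² + y_c²)·(x_a·y_b − x_b·y_a)`
(`incircleDetB`; this is the `B` of the rational analysis `IncircleStageBBounds.lean`): each 2×2
minor as the four-component block TWO-TWO-DIFF of two error-free TWO-PRODUCTs (`twoTwoProdDiff`),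
the lift `x_a²·minor` by TWO successive SCALE-EXPANSIONs with zero elimination by `x_a`
(≤ 8 then ≤ 16 components; the first one is literally ORIENT3D's cofactor term `orient3dTerm`),
likewise `y_a²·minor`, the term `(x_a² + y_a²)·minor` as their FAST-EXPANSION-SUM (≤ 32), and `B`
as two more FAST-EXPANSION-SUMs (≤ 64, ≤ 96 components).  This is the structure of
`predicates.c`'s `incircleadapt` (arrays `bc`, `axbc`, `axxbc`, `aybc`, `ayybc`, `adet`; `ca`, …,
`bdet`; `ab`, …, `cdet`; `abdet`; `fin1`); the paper describes it in prose only (§4.5, Table 4).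
We do not hold the text of `predicates.c`; the definitions below are our transcription of that
structure and are what the theorems are about — nothing is claimed about the C code itself (as
everywhere in this library: exact model over `ℚ`, abstract round-to-nearest `fl` into `F(p, emin)`,
an abstract two-product `tp`, no overflow).

THE RESULTS.
* `onGrid_of_mem_scaleExpansion`, `scaleExpansionZeroElim_coarse` — SCALE-EXPANSION(-ZEROELIM) of
  an expansion with components in `F(p, e₁)` by `b ∈ F(p, e₀)`, `e₁ + e₀ ≥ emin`, with exact
  two-products, has its components in `F(p, e₁ + e₀)` (every line of the routine is an exact error
  term or a rounding of a sum of multiples of `2^(e₁+e₀)`; the loop half is the Literature lemma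
  `onGrid_of_mem_scaleExpansionLoop`).  Consequence `orient3dTerm_coarse`: ORIENT3D's cofactor term
  (the block scaled once) lies in `F(p, 3e₀)` — what the SECOND scaling needs for its two-products.
* `incircleScale_spec` — the block scaled twice by `z ∈ F(p, e₀)`: a nonempty W-expansion of
  `≤ 16` floats with sum `z·z·(ab − cd)`, components nonzero unless `⟨0⟩` (`p ≥ 1`,
  `RoundoffBelow 2`, `2e₀, 3e₀, 4e₀ ≥ emin`, exact two-products on `F(p, e₀)²`,
  `F(p, 2e₀) × F(p, e₀)` and `F(p, 3e₀) × F(p, e₀)`).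
* `incircleTerm_spec` — one lifted cofactor term `(x² + y²)·(ab − cd)`: `≤ 32` floats (`p ≥ 4`).
* **`incircleB_spec`** — for `p ≥ 4`, a round-to-nearest with `RoundoffBelow 2` (e.g.
  ties-to-even) and six differences in `F(p, e₀)` as above: `incircleB` is a NONEMPTY weakly
  nonoverlapping expansion of `≤ 96` floats, all nonzero unless it is `⟨0⟩`, with
  `Σ = incircleDetB` EXACTLY; `incircleB_sign` — its last component has the sign of `B` and
  `B = 0 ↔ incircleB = ⟨0⟩`.
* Instances: `incircleB_fma_spec` (FMA two-product, `4e₀ ≥ emin`) and `incircleB_dekker_spec`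
  (Dekker/Shewchuk TWO-PRODUCT, split point `p ≤ 2s ≤ p + 1`, rounding odd; Theorem 18's regime
  `e₀ ≥ emin + p − 1`, `2e₀, 3e₀, 4e₀ ≥ emin + 2p − 1`).
What is NOT here: the link `x_a = a_x ⊖ d_x` to input coordinates, the stage-B error bound and
test (`estimate`, `EstimateRelativeError.lean`, and the rational analysis
`incircle_stageB_sign_of_bounds` of `IncircleStageBBounds.lean`), stages C–D.
HONEST CAVEATS: overflow is not modelled; the no-underflow hypotheses are one product deeper than
ORIENT3D's (`4e₀ ≥ emin`: for binary64 with the FMA two-product the differences must be multiples of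
`2^−268`, with Dekker's two-product multiples of `2^−242` — not arbitrary doubles).

No separate numerical evidence was gathered for this file: the theorems compose the landed block
lemma (`twoTwoProdDiff_spec`), `scaleExpansionZeroElim_spec` / `orient3dTerm_spec`
(`Orient3dStageBExpansion.lean`) and `fastExpansionSumZeroElim_spec`, each of which came with its
own evidence; the only new ingredient is the grid lemma, an exact statement.

Reference for the algorithm: J. R. Shewchuk, Discrete Comput. Geom. 18 (1997) 305–363, §4.5 and
`predicates.c` (`incircleadapt`) [Shewchuk1997].
-/

namespace Summit.Ventures.CertifiedArithmetic.Expansions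

open Literature.ComputerArithmetic.JeannerodRump2018
open Literature.ComputerArithmetic.BoldoJeannerodMelquiondMuller2023 hiding twoSum twoSum_fst
  isFloat_twoSum
open Literature.ComputerArithmetic.Shewchuk1997

variable {p : ℕ} {emin : ℤ} {fl : ℚ → ℚ}

/-! ## SCALE-EXPANSION keeps a coarse grid -/

/-- If both parts of every product `eᵢ ⊗ b` lie on a grid `2^g·ℤ` with `g ≥ emin`, then so does
every component of SCALE-EXPANSION(e, b) (the first component is the low part of the first
product; the rest is the loop, `onGrid_of_mem_scaleExpansionLoop`). -/
theorem onGrid_of_mem_scaleExpansion (hp : 1 ≤ p) (hfl : IsRoundNearest p emin fl) {g : ℤ}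
    (hg : emin ≤ g) {tp : ℚ → ℚ → ℚ × ℚ} {b : ℚ} {e : List ℚ}
    (htp : ∀ x ∈ e, OnGrid g (tp x b).1 ∧ OnGrid g (tp x b).2) :
    ∀ z ∈ scaleExpansion tp fl e b, OnGrid g z := by
  cases e with
  | nil => intro z hz; simp [scaleExpansion_nil] at hz
  | cons x xs =>
    obtain ⟨⟨hT, ht⟩, htps⟩ := List.forall_mem_cons.mp htp
    intro z hz
    rw [scaleExpansion_cons] at hz
    rcases List.mem_cons.mp hz with rfl | hz
    · exact ht
    · exact onGrid_of_mem_scaleExpansionLoop hp hfl hg hT htps z hz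

/-- **SCALE-EXPANSION-ZEROELIM on a coarse format.**  Components in `F(p, e₁)`, multiplier in
`F(p, e₀)`, `e₁ + e₀ ≥ emin`, exact two-products: every component of the (floating-point) result
is a multiple of `2^(e₁+e₀)`, i.e. a member of `F(p, e₁ + e₀)`. -/
theorem scaleExpansionZeroElim_coarse (hp : 1 ≤ p) (hfl : IsRoundNearest p emin fl) {e₁ e₀ : ℤ}
    (h : emin ≤ e₁ + e₀) {tp : ℚ → ℚ → ℚ × ℚ} {e : List ℚ} {b : ℚ}
    (he : ∀ x ∈ e, IsFloat p e₁ x) (hb : IsFloat p e₀ b)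
    (htp : ∀ x ∈ e, (tp x b).1 = fl (x * b) ∧ (tp x b).1 + (tp x b).2 = x * b)
    (hF : ∀ z ∈ scaleExpansionZeroElim tp fl e b, IsFloat p emin z) :
    ∀ z ∈ scaleExpansionZeroElim tp fl e b, IsFloat p (e₁ + e₀) z := by
  have hG : ∀ x ∈ e, OnGrid (e₁ + e₀) (tp x b).1 ∧ OnGrid (e₁ + e₀) (tp x b).2 := by
    intro x hx
    have gxb : OnGrid (e₁ + e₀) (x * b) :=
      (OnGrid.of_isFloat (he x hx)).mul (OnGrid.of_isFloat hb)
    obtain ⟨h1, h2⟩ := htp x hx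
    have ghi : OnGrid (e₁ + e₀) (tp x b).1 := by rw [h1]; exact gxb.fl_of hp hfl h
    refine ⟨ghi, ?_⟩
    have : (tp x b).2 = x * b - (tp x b).1 := by linarith
    rw [this]; exact gxb.sub ghi
  have hS := onGrid_of_mem_scaleExpansion hp hfl h hG
  intro z hz
  rcases mem_zeroElim hz with ⟨hz', -⟩ | rfl
  · exact isFloat_of_isFloat_of_onGrid (hF z hz) (hS z hz')
  · exact isFloat_zero p (e₁ + e₀)

/-- ORIENT3D's cofactor term — the block `⟨a ⊗ b − c ⊗ d⟩` scaled once by `z` — has its components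
in `F(p, 3e₀)` (factors and `z` in `F(p, e₀)`, `2e₀, 3e₀ ≥ emin`, exact two-products on
`F(p, e₀)²` and `F(p, 2e₀) × F(p, e₀)`). -/
theorem orient3dTerm_coarse (hp : 1 ≤ p) (hfl : IsRoundNearest p emin fl)
    (hfl2 : RoundoffBelow 2 fl) {e₀ : ℤ} (h2 : emin ≤ e₀ + e₀) (h3 : emin ≤ e₀ + e₀ + e₀)
    {tp : ℚ → ℚ → ℚ × ℚ}
    (htp : ∀ x y, IsFloat p e₀ x → IsFloat p e₀ y → ExactTwoProd p emin fl tp x y)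
    (htp' : ∀ x y, IsFloat p (e₀ + e₀) x → IsFloat p e₀ y → ExactTwoProd p emin fl tp x y)
    {a b c d z : ℚ} (ha : IsFloat p e₀ a) (hb : IsFloat p e₀ b) (hc : IsFloat p e₀ c)
    (hd : IsFloat p e₀ d) (hz : IsFloat p e₀ z) :
    ∀ x ∈ orient3dTerm tp fl a b c d z, IsFloat p (e₀ + e₀ + e₀) x := by
  obtain ⟨-, -, F1, -, -, -⟩ := orient3dTerm_spec hp hfl hfl2 h2 h3 htp htp' ha hb hc hd hz
  have GB := twoTwoProdDiff_coarse hp hfl hfl2 h2 ha hb hc hd (htp _ _ ha hb) (htp _ _ hc hd)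
  have htpS : ∀ x ∈ twoTwoProdDiff tp fl a b c d,
      (tp x z).1 = fl (x * z) ∧ (tp x z).1 + (tp x z).2 = x * z := fun x hx =>
    let h := htp' x z (GB x hx) hz
    ⟨h.1, h.2.1⟩
  exact scaleExpansionZeroElim_coarse hp hfl h3 GB hz htpS F1

/-! ## INCIRCLE, stage B -/

/-- The block `⟨a ⊗ b − c ⊗ d⟩` scaled TWICE by `z` with SCALE-EXPANSION-ZEROELIM — `predicates.c`:
`axbc = scale_expansion_zeroelim(4, bc, adx)`, `axxbc = scale_expansion_zeroelim(axbclen, axbc,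
adx)` (the first scaling is `orient3dTerm`). -/
def incircleScale (tp : ℚ → ℚ → ℚ × ℚ) (fl : ℚ → ℚ) (a b c d z : ℚ) : List ℚ :=
  scaleExpansionZeroElim tp fl (orient3dTerm tp fl a b c d z) z

/-- One lifted cofactor term of stage B, `(x² + y²)·(ab − cd)`: the FAST-EXPANSION-SUM with zero
elimination of the two double scalings — `predicates.c`: `adet = axxbc ⊞ ayybc`. -/
def incircleTerm (tp : ℚ → ℚ → ℚ × ℚ) (fl : ℚ → ℚ) (a b c d x y : ℚ) : List ℚ :=
  fastExpansionSumZeroElim fl (incircleScale tp fl a b c d x) (incircleScale tp fl a b c d y)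

/-- The INCIRCLE determinant of the six COMPUTED differences, the minors written as `predicates.c`
writes them (`bc = x_b·y_c − x_c·y_b`, `ca = x_c·y_a − x_a·y_c`, `ab = x_a·y_b − x_b·y_a`) — the `B`
of `IncircleStageBBounds.lean`. -/
def incircleDetB (xa ya xb yb xc yc : ℚ) : ℚ :=
  (xa * xa + ya * ya) * (xb * yc - xc * yb) + (xb * xb + yb * yb) * (xc * ya - xa * yc)
    + (xc * xc + yc * yc) * (xa * yb - xb * ya)

/-- **STAGE B OF INCIRCLE, the expansion** (`predicates.c` `incircleadapt`: `adet`, `bdet`, `cdet`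
the three lifted terms, `abdet = adet ⊞ bdet`, `fin1 = abdet ⊞ cdet`, all with zero elimination),
over a two-product `tp` and a rounding `fl`; arguments = the six computed differences
`x_a, y_a, x_b, y_b, x_c, y_c`. -/
def incircleB (tp : ℚ → ℚ → ℚ × ℚ) (fl : ℚ → ℚ) (xa ya xb yb xc yc : ℚ) : List ℚ :=
  fastExpansionSumZeroElim fl
    (fastExpansionSumZeroElim fl (incircleTerm tp fl xb yc xc yb xa ya)
      (incircleTerm tp fl xc ya xa yc xb yb))
    (incircleTerm tp fl xa yb xb ya xc yc)

/-- **The block scaled twice is an exact W-expansion of ≤ 16 floats.**  `p ≥ 1`, `RoundoffBelow 2`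
round-to-nearest, factors and `z` in `F(p, e₀)` with `2e₀, 3e₀, 4e₀ ≥ emin`, error-free
two-products on `F(p, e₀)²`, `F(p, 2e₀) × F(p, e₀)` and `F(p, 3e₀) × F(p, e₀)`: then `incircleScale`
is a nonempty W-expansion of floats with `Σ = z·z·(ab − cd)`, components nonzero unless `⟨0⟩`,
length `≤ 16`. -/
theorem incircleScale_spec (hp : 1 ≤ p) (hfl : IsRoundNearest p emin fl) (hfl2 : RoundoffBelow 2 fl)
    {e₀ : ℤ} (h2 : emin ≤ e₀ + e₀) (h3 : emin ≤ e₀ + e₀ + e₀) (h4 : emin ≤ e₀ + e₀ + e₀ + e₀)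
    {tp : ℚ → ℚ → ℚ × ℚ}
    (htp : ∀ x y, IsFloat p e₀ x → IsFloat p e₀ y → ExactTwoProd p emin fl tp x y)
    (htp' : ∀ x y, IsFloat p (e₀ + e₀) x → IsFloat p e₀ y → ExactTwoProd p emin fl tp x y)
    (htp'' : ∀ x y, IsFloat p (e₀ + e₀ + e₀) x → IsFloat p e₀ y → ExactTwoProd p emin fl tp x y)
    {a b c d z : ℚ} (ha : IsFloat p e₀ a) (hb : IsFloat p e₀ b) (hc : IsFloat p e₀ c)
    (hd : IsFloat p e₀ d) (hz : IsFloat p e₀ z) :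
    IsWeakExpansion (incircleScale tp fl a b c d z) ∧
      (incircleScale tp fl a b c d z).sum = z * z * (a * b - c * d) ∧
      (∀ x ∈ incircleScale tp fl a b c d z, IsFloat p emin x) ∧
      incircleScale tp fl a b c d z ≠ [] ∧
      ((∀ x ∈ incircleScale tp fl a b c d z, x ≠ 0) ∨ incircleScale tp fl a b c d z = [0]) ∧
      (incircleScale tp fl a b c d z).length ≤ 16 := by
  obtain ⟨W1, S1, F1, -, -, L1⟩ := orient3dTerm_spec hp hfl hfl2 h2 h3 htp htp' ha hb hc hd hz
  have G1 := orient3dTerm_coarse hp hfl hfl2 h2 h3 htp htp' ha hb hc hd hz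
  obtain ⟨Mb, kb, hMb, hkb, hrep⟩ := hz
  have heU : ∀ x ∈ orient3dTerm tp fl a b c d z, IsFloat p (emin - kb) x :=
    fun x hx => isFloat_of_emin_le (by omega) (G1 x hx)
  have htpS : ∀ x ∈ orient3dTerm tp fl a b c d z,
      (tp x z).1 = fl (x * z) ∧ (tp x z).1 + (tp x z).2 = x * z := fun x hx =>
    let h := htp'' x z (G1 x hx) ⟨Mb, kb, hMb, hkb, hrep⟩
    ⟨h.1, h.2.1⟩
  obtain ⟨hW, hS, hF, hne, hZ, hL⟩ :=
    scaleExpansionZeroElim_spec hp hfl hfl2 hrep hMb F1 heU W1 htpS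
  refine ⟨hW, by rw [incircleScale, hS, S1]; ring, hF, hne, hZ, ?_⟩
  rw [incircleScale]
  refine le_trans hL ?_
  have := L1
  omega

/-- **One lifted cofactor term is an exact W-expansion of ≤ 32 floats** with
`Σ = (x² + y²)·(ab − cd)` (`p ≥ 4` for the FAST-EXPANSION-SUM; hypotheses as for `incircleScale`,
with `x, y ∈ F(p, e₀)`). -/
theorem incircleTerm_spec (hp : 4 ≤ p) (hfl : IsRoundNearest p emin fl) (hfl2 : RoundoffBelow 2 fl)
    {e₀ : ℤ} (h2 : emin ≤ e₀ + e₀) (h3 : emin ≤ e₀ + e₀ + e₀) (h4 : emin ≤ e₀ + e₀ + e₀ + e₀)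
    {tp : ℚ → ℚ → ℚ × ℚ}
    (htp : ∀ x y, IsFloat p e₀ x → IsFloat p e₀ y → ExactTwoProd p emin fl tp x y)
    (htp' : ∀ x y, IsFloat p (e₀ + e₀) x → IsFloat p e₀ y → ExactTwoProd p emin fl tp x y)
    (htp'' : ∀ x y, IsFloat p (e₀ + e₀ + e₀) x → IsFloat p e₀ y → ExactTwoProd p emin fl tp x y)
    {a b c d x y : ℚ} (ha : IsFloat p e₀ a) (hb : IsFloat p e₀ b) (hc : IsFloat p e₀ c)
    (hd : IsFloat p e₀ d) (hx : IsFloat p e₀ x) (hy : IsFloat p e₀ y) :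
    IsWeakExpansion (incircleTerm tp fl a b c d x y) ∧
      (incircleTerm tp fl a b c d x y).sum = (x * x + y * y) * (a * b - c * d) ∧
      (∀ w ∈ incircleTerm tp fl a b c d x y, IsFloat p emin w) ∧
      incircleTerm tp fl a b c d x y ≠ [] ∧
      ((∀ w ∈ incircleTerm tp fl a b c d x y, w ≠ 0) ∨ incircleTerm tp fl a b c d x y = [0]) ∧
      (incircleTerm tp fl a b c d x y).length ≤ 32 := by
  have hp1 : 1 ≤ p := le_trans (by norm_num) hp
  obtain ⟨W1, S1, F1, -, -, L1⟩ :=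
    incircleScale_spec hp1 hfl hfl2 h2 h3 h4 htp htp' htp'' ha hb hc hd hx
  obtain ⟨W2, S2, F2, -, -, L2⟩ :=
    incircleScale_spec hp1 hfl hfl2 h2 h3 h4 htp htp' htp'' ha hb hc hd hy
  obtain ⟨W, S, F, N, Z, L⟩ := fastExpansionSumZeroElim_spec hp hfl hfl2 F1 W1 F2 W2
  refine ⟨W, ?_, F, N, Z, ?_⟩
  · show (fastExpansionSumZeroElim fl _ _).sum = _
    rw [S, S1, S2]; ring
  · show (fastExpansionSumZeroElim fl _ _).length ≤ 32
    refine le_trans L ?_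
    have := add_le_add L1 L2
    omega

/-- **THEOREM (INCIRCLE's stage-B expansion is an exact W-expansion).**  Let `p ≥ 4`, `fl` a
round-to-nearest whose roundoff lies 2-below its result (e.g. ties-to-even), the six differences
in `F(p, e₀)` with `2e₀, 3e₀, 4e₀ ≥ emin`, and `tp` a two-product error-free on `F(p, e₀)²`, on
`F(p, 2e₀) × F(p, e₀)` and on `F(p, 3e₀) × F(p, e₀)`.  Then `incircleB` is a NONEMPTY weakly
nonoverlapping expansion (hence nonoverlapping and increasing) of at most 96 floats, all nonzero
unless it is `⟨0⟩`, whose sum is `incircleDetB` EXACTLY. -/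
theorem incircleB_spec (hp : 4 ≤ p) (hfl : IsRoundNearest p emin fl) (hfl2 : RoundoffBelow 2 fl)
    {e₀ : ℤ} (h2 : emin ≤ e₀ + e₀) (h3 : emin ≤ e₀ + e₀ + e₀) (h4 : emin ≤ e₀ + e₀ + e₀ + e₀)
    {tp : ℚ → ℚ → ℚ × ℚ}
    (htp : ∀ x y, IsFloat p e₀ x → IsFloat p e₀ y → ExactTwoProd p emin fl tp x y)
    (htp' : ∀ x y, IsFloat p (e₀ + e₀) x → IsFloat p e₀ y → ExactTwoProd p emin fl tp x y)
    (htp'' : ∀ x y, IsFloat p (e₀ + e₀ + e₀) x → IsFloat p e₀ y → ExactTwoProd p emin fl tp x y)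
    {xa ya xb yb xc yc : ℚ} (hxa : IsFloat p e₀ xa) (hya : IsFloat p e₀ ya)
    (hxb : IsFloat p e₀ xb) (hyb : IsFloat p e₀ yb) (hxc : IsFloat p e₀ xc)
    (hyc : IsFloat p e₀ yc) :
    IsWeakExpansion (incircleB tp fl xa ya xb yb xc yc) ∧
      (incircleB tp fl xa ya xb yb xc yc).sum = incircleDetB xa ya xb yb xc yc ∧
      (∀ w ∈ incircleB tp fl xa ya xb yb xc yc, IsFloat p emin w) ∧
      incircleB tp fl xa ya xb yb xc yc ≠ [] ∧
      ((∀ w ∈ incircleB tp fl xa ya xb yb xc yc, w ≠ 0) ∨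
        incircleB tp fl xa ya xb yb xc yc = [0]) ∧
      (incircleB tp fl xa ya xb yb xc yc).length ≤ 96 := by
  obtain ⟨W1, S1, F1, -, -, L1⟩ :=
    incircleTerm_spec hp hfl hfl2 h2 h3 h4 htp htp' htp'' hxb hyc hxc hyb hxa hya
  obtain ⟨W2, S2, F2, -, -, L2⟩ :=
    incircleTerm_spec hp hfl hfl2 h2 h3 h4 htp htp' htp'' hxc hya hxa hyc hxb hyb
  obtain ⟨W3, S3, F3, -, -, L3⟩ :=
    incircleTerm_spec hp hfl hfl2 h2 h3 h4 htp htp' htp'' hxa hyb hxb hya hxc hyc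
  obtain ⟨W12, S12, F12, -, -, L12⟩ := fastExpansionSumZeroElim_spec hp hfl hfl2 F1 W1 F2 W2
  obtain ⟨W, S, Fl, N, Z, L⟩ := fastExpansionSumZeroElim_spec hp hfl hfl2 F12 W12 F3 W3
  refine ⟨W, ?_, Fl, N, Z, ?_⟩
  · show (fastExpansionSumZeroElim fl _ _).sum = _
    rw [S, S12, S1, S2, S3, incircleDetB]
  · show (fastExpansionSumZeroElim fl _ _).length ≤ 96
    refine le_trans L ?_
    have := le_trans L12 (max_le_max (add_le_add L1 L2) le_rfl)
    omega

/-- **The sign of `B` from the expansion** (Shewchuk's §2.8 tests on the zero-eliminated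
nonoverlapping expansion): the LAST component of `incircleB` decides `B > 0`, `B < 0`, and
`B = 0 ↔ incircleB = ⟨0⟩`.  (Stage B of the C code uses `estimate` instead; this is the exact
information the expansion carries.) -/
theorem incircleB_sign (hp : 4 ≤ p) (hfl : IsRoundNearest p emin fl) (hfl2 : RoundoffBelow 2 fl)
    {e₀ : ℤ} (h2 : emin ≤ e₀ + e₀) (h3 : emin ≤ e₀ + e₀ + e₀) (h4 : emin ≤ e₀ + e₀ + e₀ + e₀)
    {tp : ℚ → ℚ → ℚ × ℚ}
    (htp : ∀ x y, IsFloat p e₀ x → IsFloat p e₀ y → ExactTwoProd p emin fl tp x y)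
    (htp' : ∀ x y, IsFloat p (e₀ + e₀) x → IsFloat p e₀ y → ExactTwoProd p emin fl tp x y)
    (htp'' : ∀ x y, IsFloat p (e₀ + e₀ + e₀) x → IsFloat p e₀ y → ExactTwoProd p emin fl tp x y)
    {xa ya xb yb xc yc : ℚ} (hxa : IsFloat p e₀ xa) (hya : IsFloat p e₀ ya)
    (hxb : IsFloat p e₀ xb) (hyb : IsFloat p e₀ yb) (hxc : IsFloat p e₀ xc)
    (hyc : IsFloat p e₀ yc) :
    ∃ hD : incircleB tp fl xa ya xb yb xc yc ≠ [],
      (0 < incircleDetB xa ya xb yb xc yc ↔ 0 < (incircleB tp fl xa ya xb yb xc yc).getLast hD) ∧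
        (incircleDetB xa ya xb yb xc yc < 0 ↔ (incircleB tp fl xa ya xb yb xc yc).getLast hD < 0) ∧
        (incircleDetB xa ya xb yb xc yc = 0 ↔ incircleB tp fl xa ya xb yb xc yc = [0]) := by
  obtain ⟨hW, hS, hF, hne, hZ, -⟩ :=
    incircleB_spec hp hfl hfl2 h2 h3 h4 htp htp' htp'' hxa hya hxb hyb hxc hyc
  refine ⟨hne, ?_⟩
  rw [← hS]
  rcases hZ with hnz | h0
  · obtain ⟨h1, h2, h3⟩ :=
      sign_sum_of_getLast_ne_zero hF hW.isExpansion hne (hnz _ (List.getLast_mem hne))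
    refine ⟨h1, h2, ⟨fun h => absurd h h3, fun h => ?_⟩⟩
    exfalso
    rw [h] at hnz
    exact hnz 0 (List.mem_singleton_self 0) rfl
  · have key : ∀ (L : List ℚ) (h : L ≠ []), L = [0] → L.getLast h = 0 ∧ L.sum = 0 := by
      rintro L h rfl; exact ⟨rfl, by simp⟩
    obtain ⟨hl, hs0⟩ := key _ hne h0
    rw [hl, hs0]
    exact ⟨Iff.rfl, Iff.rfl, ⟨fun _ => h0, fun _ => rfl⟩⟩

/-! ## Instances: FMA two-product; Dekker two-product -/

/-- **Stage-B expansion with the FMA two-product** (`2Prod_FMA`, any `RoundoffBelow 2`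
round-to-nearest, `p ≥ 4`): exact W-expansion of ≤ 96 floats for differences in `F(p, e₀)`,
`2e₀, 3e₀, 4e₀ ≥ emin`. -/
theorem incircleB_fma_spec (hp : 4 ≤ p) (hfl : IsRoundNearest p emin fl) (hfl2 : RoundoffBelow 2 fl)
    {e₀ : ℤ} (h2 : emin ≤ e₀ + e₀) (h3 : emin ≤ e₀ + e₀ + e₀) (h4 : emin ≤ e₀ + e₀ + e₀ + e₀)
    {xa ya xb yb xc yc : ℚ} (hxa : IsFloat p e₀ xa) (hya : IsFloat p e₀ ya)
    (hxb : IsFloat p e₀ xb) (hyb : IsFloat p e₀ yb) (hxc : IsFloat p e₀ xc)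
    (hyc : IsFloat p e₀ yc) :
    IsWeakExpansion (incircleB (twoProdFMA fl) fl xa ya xb yb xc yc) ∧
      (incircleB (twoProdFMA fl) fl xa ya xb yb xc yc).sum = incircleDetB xa ya xb yb xc yc ∧
      (∀ w ∈ incircleB (twoProdFMA fl) fl xa ya xb yb xc yc, IsFloat p emin w) ∧
      incircleB (twoProdFMA fl) fl xa ya xb yb xc yc ≠ [] ∧
      (incircleB (twoProdFMA fl) fl xa ya xb yb xc yc).length ≤ 96 := by
  have hp1 : 1 ≤ p := le_trans (by norm_num) hp
  obtain ⟨W, S, F, N, -, L⟩ := incircleB_spec hp hfl hfl2 h2 h3 h4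
    (fun x y hx hy => exactTwoProd_twoProdFMA₂ hp1 hfl h2 hx hy)
    (fun x y hx hy => exactTwoProd_twoProdFMA₂ hp1 hfl h3 hx hy)
    (fun x y hx hy => exactTwoProd_twoProdFMA₂ hp1 hfl h4 hx hy) hxa hya hxb hyb hxc hyc
  exact ⟨W, S, F, N, L⟩

/-- **Stage-B expansion with Shewchuk's TWO-PRODUCT** (Dekker, split point `s`, `p ≤ 2s ≤ p + 1`,
rounding odd and `RoundoffBelow 2`, `p ≥ 4`) in Theorem 18's no-underflow regime for the three
kinds of products: `e₀ ≥ emin + p − 1`, `2e₀, 3e₀, 4e₀ ≥ emin + 2p − 1`. -/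
theorem incircleB_dekker_spec (hp : 4 ≤ p) {s : ℕ} (hs2 : p ≤ 2 * s) (hs2' : 2 * s ≤ p + 1)
    (hfl : IsRoundNearest p emin fl) (hodd : ∀ t, fl (-t) = -fl t) (hfl2 : RoundoffBelow 2 fl)
    {e₀ : ℤ} (h1 : emin + p - 1 ≤ e₀) (h2 : emin + 2 * p - 1 ≤ e₀ + e₀)
    (h3 : emin + 2 * p - 1 ≤ e₀ + e₀ + e₀) (h4 : emin + 2 * p - 1 ≤ e₀ + e₀ + e₀ + e₀)
    {xa ya xb yb xc yc : ℚ} (hxa : IsFloat p e₀ xa) (hya : IsFloat p e₀ ya)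
    (hxb : IsFloat p e₀ xb) (hyb : IsFloat p e₀ yb) (hxc : IsFloat p e₀ xc)
    (hyc : IsFloat p e₀ yc) :
    IsWeakExpansion (incircleB (twoProduct fl s) fl xa ya xb yb xc yc) ∧
      (incircleB (twoProduct fl s) fl xa ya xb yb xc yc).sum = incircleDetB xa ya xb yb xc yc ∧
      (∀ w ∈ incircleB (twoProduct fl s) fl xa ya xb yb xc yc, IsFloat p emin w) ∧
      incircleB (twoProduct fl s) fl xa ya xb yb xc yc ≠ [] ∧
      (incircleB (twoProduct fl s) fl xa ya xb yb xc yc).length ≤ 96 := by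
  have h2' : emin ≤ e₀ + e₀ := by omega
  have h3' : emin ≤ e₀ + e₀ + e₀ := by omega
  have h4' : emin ≤ e₀ + e₀ + e₀ + e₀ := by omega
  obtain ⟨W, S, F, N, -, L⟩ := incircleB_spec hp hfl hfl2 h2' h3' h4'
    (fun x y hx hy => exactTwoProd_twoProduct₂ hp hs2 hs2' hfl hodd h1 h1 h2 hx hy)
    (fun x y hx hy => exactTwoProd_twoProduct₂ hp hs2 hs2' hfl hodd (by omega) h1 h3 hx hy)
    (fun x y hx hy => exactTwoProd_twoProduct₂ hp hs2 hs2' hfl hodd (by omega) h1 h4 hx hy)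
    hxa hya hxb hyb hxc hyc
  exact ⟨W, S, F, N, L⟩

end Summit.Ventures.CertifiedArithmetic.Expansions
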